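import Mathlib.Analysis.Calculus.Deriv.Shift
import Literature.Analysis.FunctionSpaces.FlatTorusProofs
import HarnessLib

/-!
# Functions of one coordinate on the flat torus

A `1`-periodic `g : ℝ → F` read on the `k`-th coordinate of the fundamental-domain representative,
`x ↦ g (repr x k)`, is a genuine function on `𝕋^d = ℝ^d/ℤ^d` (Grafakos, §3.1.1: functions on `𝕋ⁿ` are
the `1`-periodic functions on `ℝⁿ`): its global lift is `y ↦ g (y k)` (`lift_coordFun_apply`), its
re-centred lift is `v ↦ g (repr x k + v k)` (`liftAt_coordFun_apply`), and its torus partial derivatives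
are `∂ₖ = g' (repr x k)` and `∂ᵢ = 0` for `i ≠ k` (`partialDeriv_coordFun_self`,
`partialDeriv_coordFun_of_ne`) — unconditionally, with Mathlib's junk-value convention for `deriv` on
both sides. These are the bookkeeping lemmas for shear flows `u(x) = (a · U(x₂), 0)` on `𝕋²`
(`Literature.Analysis.FluidPDE.SawtoothCascade`). All proofs are elementary. [folklore]

## References
* L. Grafakos, *Classical Fourier Analysis*, 3rd ed., Springer GTM 249 (2014), §3.1.1.
-/

noncomputable section

open Set

namespace Literature.Analysis.FunctionSpaces.Torus

variable {d : Type*} [Fintype d] [DecidableEq d] {F : Type*}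

/-- The global lift of the coordinate function `x ↦ g (repr x k)` of a `1`-periodic `g` is `y ↦ g (y k)`.
[cite: Grafakos2014, §3.1.1 (functions on 𝕋ⁿ ≃ 1-periodic functions on ℝⁿ)] -/
theorem lift_coordFun_apply {g : ℝ → F} (hg : Function.Periodic g 1) (k : d) (y : EuclideanSpace ℝ d) :
    lift (fun x => g (repr x k)) y = g (y k) := by
  obtain ⟨m, hm⟩ := exists_repr_proj_eq_add_latticeVec_holds y
  rw [lift_apply, hm]
  simpa [latticeVec_apply] using (hg.int_mul (m k)) (y k)

/-- The re-centred lift of the coordinate function `x ↦ g (repr x k)` of a `1`-periodic `g` at `x` is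
`v ↦ g (repr x k + v k)`. [cite: Grafakos2014, §3.1.1 (functions on 𝕋ⁿ ≃ 1-periodic functions on ℝⁿ)] -/
theorem liftAt_coordFun_apply {g : ℝ → F} (hg : Function.Periodic g 1) (k : d) (x : UnitAddTorus d)
    (v : EuclideanSpace ℝ d) :
    liftAt (fun x => g (repr x k)) x v = g (repr x k + v k) := by
  have h := liftAt_proj (fun x => g (repr x k)) (repr x)
  rw [proj_repr] at h
  rw [h, Function.comp_apply, lift_coordFun_apply hg]
  rfl

variable [NormedAddCommGroup F] [NormedSpace ℝ F]

/-- **`∂ₖ` of a coordinate function**: `∂ₖ (x ↦ g (repr x k)) = g' (repr x k)` for `1`-periodic `g`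
(no differentiability hypothesis: both sides take Mathlib's junk value `0` together).
[cite: Grafakos2014, §3.1.1 (functions on 𝕋ⁿ ≃ 1-periodic functions on ℝⁿ)] -/
theorem partialDeriv_coordFun_self {g : ℝ → F} (hg : Function.Periodic g 1) (k : d) (x : UnitAddTorus d) :
    partialDeriv k (fun x => g (repr x k)) x = deriv g (repr x k) := by
  have h : (fun t : ℝ => (fun x => g (repr x k)) (x + proj (t • EuclideanSpace.single k (1 : ℝ)))) =
      fun t => g (repr x k + t) := by
    funext t
    have h1 := liftAt_coordFun_apply hg k x (t • EuclideanSpace.single k (1 : ℝ))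
    rw [liftAt_apply] at h1
    simp only
    rw [h1]
    simp
  show deriv _ 0 = _
  rw [h, deriv_comp_const_add, add_zero]

/-- **`∂ᵢ` of a coordinate function vanishes for `i ≠ k`**: `∂ᵢ (x ↦ g (repr x k)) = 0`.
[cite: Grafakos2014, §3.1.1 (functions on 𝕋ⁿ ≃ 1-periodic functions on ℝⁿ)] -/
theorem partialDeriv_coordFun_of_ne {g : ℝ → F} (hg : Function.Periodic g 1) {i k : d} (hik : i ≠ k)
    (x : UnitAddTorus d) :
    partialDeriv i (fun x => g (repr x k)) x = 0 := by
  have h : (fun t : ℝ => (fun x => g (repr x k)) (x + proj (t • EuclideanSpace.single i (1 : ℝ)))) =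
      fun _ => g (repr x k) := by
    funext t
    have h1 := liftAt_coordFun_apply hg k x (t • EuclideanSpace.single i (1 : ℝ))
    rw [liftAt_apply] at h1
    simp only
    rw [h1]
    simp [hik.symm]
  show deriv _ 0 = _
  rw [h, deriv_const]

end Literature.Analysis.FunctionSpaces.Torus

end
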